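import Mathlib
import Summits.NavierStokesRegularity.NavierStokesRegularity.Theorems.SubOnsagerCeilingGapChain21
import Summits.NavierStokesRegularity.NavierStokesRegularity.Theorems.SubOnsagerCeilingGapArchitectures4
import HarnessLib

/-!
# RUNGS 19–29 transported to the architecture classes: uniform KP permutation networks, uniform fan networks, the
# uniform 2-cycle and MIXED permutation networks at EVERY scale ratio `1 + ε₀ ∈ [5/4, 2]` — the whole ratio range of
# the registered stub `stub_primaryGradedLargeRatio` (`1/4 < ε₀ ≤ 1`)
(helper file for crux stmt-NavierStokesRegularity-27057 `SubOnsagerCeiling.ForwardTailCeilingKP`, `--supports … --as helper`;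
hand leafhand-ns-subonsagerceiling-4 gen 22, after the template of `SubOnsagerCeilingGapArchitectures4` (leafhand g0) and of LEAD SOC
g11/g12's `SubOnsagerCeilingGapArchitectures{,2,3}`; also a corner for the sister crux 27130)

The hands 4-g20 / 4-g21 certified the ν-uniform one-mode chain bound (`θ = 101/200`, `D = 100`) on the eleven slices
`ε₀ ∈ [1/4, 9/25]` (`dyadicGapRange11_shellBarrier` … `dyadicGapRange21_shellBarrier`, RUNGS 19–29: quadratic history floor, second
top-pair ratio cap, steep near-cap cubics, shifted corner cap — all as DATA of the spec-list route `SubOnsagerCeilingGapSpec*`).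
This file is the pure glue that makes that descent available BY NAME to every consumer of the chain bound:

* `dyadicGap21Low_shellBarrier` / `dyadicGap21All_shellBarrier` — the one-mode chain bound with EXPLICIT constants glued over
  `ε₀ ∈ [1/4, 9/25]` (eleven slices) and over the whole landed range `ε₀ ∈ [1/4, 1]` (with `dyadicGap10All_shellBarrier`) — the
  form every strand transfer consumes;
* `kpPerm_shellBarrier_gapRange21`, `kpPermGap21Wide_shellBarrierAt`, `kpPermGap21Wide_ceilingAt` — uniform KP permutation
  networks at every `ε₀ ∈ [1/4, 1]` (was `[9/25, 1]`, `kpPermGap10Wide_*`);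
* `kpFan_shellBarrier_gapRange21`, `kpFanGap21Wide_shellBarrierAt`, `kpFanGap21Wide_ceilingAt` — uniform fan networks, same range;
* `kpTwoCycle_shellBarrier_gapRange21`, `kpTwoCycleGap21Wide_shellBarrierAt`, `kpTwoCycleGap21Wide_ceilingAt` — the uniform 2-cycle;
* `kpPerm_mixed_primaryGraded_gap21` — MIXED permutation networks (every orbit uniform-live or with a dead predecessor;
  `SubOnsagerCeilingKPMixedPerm`) satisfy the conclusion of `PrimaryGradedAt` at every `ε₀ ∈ [1/4, 1]`.

So the architecture corners of the LEAD's composition `ForwardTailCeilingKP_of` (RUNGS 6–8, now at `9/20`) may start at `b = 5/4`,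
i.e. they cover the whole ratio range of STUB 1 (replace `kpPermGap3Wide_ceilingAt` / `kpFanGap3Wide_ceilingAt` /
`kpTwoCycleGap3Wide_ceilingAt` and `9/20` by the `Gap21Wide` versions and `1/4`). HONEST FRAMING: MODEL lattice ODEs (route
SubOnsagerCeiling, rung TL-M2Break); pure glue over landed certificates; nothing here bears on Navier–Stokes regularity and no stub,
crux or summit is proved. [cite: BarbatoMorandinRomito2011, §2 Lemma 2.1, §3.2] [cite: Tao2016AveragedNS, §4 (4.5), (4.13)]
-/

noncomputable section

-- the sub-problem namespace `NavierStokesRegularity.NavierStokesRegularity` is the tree's layout (D-0017)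
set_option linter.dupNamespace false

namespace Summit.NavierStokesRegularity.NavierStokesRegularity.Theorems

open Set
open Literature.Analysis.FluidPDE.TaoCascade
open Summit.NavierStokesRegularity.NavierStokesRegularity.Theorems.SubOnsagerCeiling
open Summit.NavierStokesRegularity.NavierStokesRegularity.Theses

/-! ## The chain bound with explicit constants, glued over the landed slices -/

/-- **The one-mode chain bound (`θ = 101/200`, `D = 100`) at every `ε₀ ∈ [1/4, 9/25]`**: RUNGS 19–29
(`dyadicGapRange11_shellBarrier` … `dyadicGapRange21_shellBarrier`, hands 4-g20 / 4-g21) glued BY NAME. MODEL lattice statement.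
[cite: BarbatoMorandinRomito2011, §3.2] -/
theorem dyadicGap21Low_shellBarrier {c ε₀ : ℝ} (hc : 0 < c) (hε : (1 : ℝ) / 4 ≤ ε₀) (hε1 : ε₀ ≤ (9 : ℝ) / 25)
    {α : Fin 4 → Fin 4 → Fin 4 → ℤ × ℤ × ℤ → ℝ}
    (hα : ∀ (i₁ i₂ i₃ : Fin 4) (μ : ℤ × ℤ × ℤ), α i₁ i₂ i₃ μ = c * dyadicTable i₁ i₂ i₃ μ) :
    ∀ ν : ℝ, 0 < ν → ∀ (X₀ : Fin 4 → ℝ) (s : ℝ), 0 < s → ∀ X : Fin 4 → ℤ → ℝ → ℝ,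
      (∀ (i : Fin 4) (k : ℤ), X i k 0 = if k = 0 then X₀ i else 0) →
      (∀ (i : Fin 4) (k : ℤ), k < 0 → ∀ t : ℝ, X i k t = 0) →
      (∃ M : ℝ, ∀ (t : ℝ) (i : Fin 4) (k : ℤ), (1 + (1 + ε₀) ^ ((10 : ℝ) * k)) * |X i k t| ≤ M) →
      (∀ (i : Fin 4) (k : ℤ), Continuous (X i k)) →
      (∀ (i : Fin 4) (k : ℤ), ∀ t ∈ Set.Icc (0 : ℝ) s, HasDerivWithinAt (X i k)
        (quadTerm ε₀ α X i k t - ν * (1 + ε₀) ^ ((2 : ℝ) * k) * X i k t)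
        (Set.Icc (0 : ℝ) s) t) →
      (∀ t ∈ Set.Icc (0 : ℝ) s, ∀ (i : Fin 4) (k : ℤ), 1 ≤ k → 0 ≤ X i k t) →
      ∀ t ∈ Set.Icc (0 : ℝ) s, ∀ (i : Fin 4) (k : ℕ),
        (1 + ε₀) ^ (2 * (101 / 200) * (k : ℝ)) * ((1 / 2 : ℝ) * X i (k : ℤ) t ^ 2) ≤
          100 * (∑ j : Fin 4, (1 / 2 : ℝ) * X₀ j ^ 2) := by
  rcases le_total ε₀ ((101 : ℝ) / 400) with h1 | h1
  · exact dyadicGapRange21_shellBarrier hc hε h1 hα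
  rcases le_total ε₀ ((51 : ℝ) / 200) with h2 | h2
  · exact dyadicGapRange20_shellBarrier hc h1 h2 hα
  rcases le_total ε₀ ((13 : ℝ) / 50) with h3 | h3
  · exact dyadicGapRange19_shellBarrier hc h2 h3 hα
  rcases le_total ε₀ ((53 : ℝ) / 200) with h4 | h4
  · exact dyadicGapRange18_shellBarrier hc h3 h4 hα
  rcases le_total ε₀ ((27 : ℝ) / 100) with h5 | h5
  · exact dyadicGapRange17_shellBarrier hc h4 h5 hα
  rcases le_total ε₀ ((7 : ℝ) / 25) with h6 | h6
  · exact dyadicGapRange16_shellBarrier hc h5 h6 hα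
  rcases le_total ε₀ ((29 : ℝ) / 100) with h7 | h7
  · exact dyadicGapRange15_shellBarrier hc h6 h7 hα
  rcases le_total ε₀ ((3 : ℝ) / 10) with h8 | h8
  · exact dyadicGapRange14_shellBarrier hc h7 h8 hα
  rcases le_total ε₀ ((8 : ℝ) / 25) with h9 | h9
  · exact dyadicGapRange13_shellBarrier hc h8 h9 hα
  rcases le_total ε₀ ((7 : ℝ) / 20) with h10 | h10
  · exact dyadicGapRange12_shellBarrier hc h9 h10 hα
  · exact dyadicGapRange11_shellBarrier hc h10 hε1 hα

/-- **The one-mode chain bound (`θ = 101/200`, `D = 100`) at every `ε₀ ∈ [1/4, 1]`** — the whole landed chain range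
`b ∈ [5/4, 2]`, twenty-four slices glued BY NAME (`dyadicGap21Low_shellBarrier` below `9/25`, `dyadicGap10All_shellBarrier` above).
This is the ratio range of the registered stub `stub_primaryGradedLargeRatio`, on the one-mode chain class. MODEL lattice statement.
[cite: BarbatoMorandinRomito2011, §3.2] -/
theorem dyadicGap21All_shellBarrier {c ε₀ : ℝ} (hc : 0 < c) (hε : (1 : ℝ) / 4 ≤ ε₀) (hε1 : ε₀ ≤ 1)
    {α : Fin 4 → Fin 4 → Fin 4 → ℤ × ℤ × ℤ → ℝ}
    (hα : ∀ (i₁ i₂ i₃ : Fin 4) (μ : ℤ × ℤ × ℤ), α i₁ i₂ i₃ μ = c * dyadicTable i₁ i₂ i₃ μ) :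
    ∀ ν : ℝ, 0 < ν → ∀ (X₀ : Fin 4 → ℝ) (s : ℝ), 0 < s → ∀ X : Fin 4 → ℤ → ℝ → ℝ,
      (∀ (i : Fin 4) (k : ℤ), X i k 0 = if k = 0 then X₀ i else 0) →
      (∀ (i : Fin 4) (k : ℤ), k < 0 → ∀ t : ℝ, X i k t = 0) →
      (∃ M : ℝ, ∀ (t : ℝ) (i : Fin 4) (k : ℤ), (1 + (1 + ε₀) ^ ((10 : ℝ) * k)) * |X i k t| ≤ M) →
      (∀ (i : Fin 4) (k : ℤ), Continuous (X i k)) →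
      (∀ (i : Fin 4) (k : ℤ), ∀ t ∈ Set.Icc (0 : ℝ) s, HasDerivWithinAt (X i k)
        (quadTerm ε₀ α X i k t - ν * (1 + ε₀) ^ ((2 : ℝ) * k) * X i k t)
        (Set.Icc (0 : ℝ) s) t) →
      (∀ t ∈ Set.Icc (0 : ℝ) s, ∀ (i : Fin 4) (k : ℤ), 1 ≤ k → 0 ≤ X i k t) →
      ∀ t ∈ Set.Icc (0 : ℝ) s, ∀ (i : Fin 4) (k : ℕ),
        (1 + ε₀) ^ (2 * (101 / 200) * (k : ℝ)) * ((1 / 2 : ℝ) * X i (k : ℤ) t ^ 2) ≤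
          100 * (∑ j : Fin 4, (1 / 2 : ℝ) * X₀ j ^ 2) := by
  rcases le_total ε₀ ((9 : ℝ) / 25) with h0 | h0
  · exact dyadicGap21Low_shellBarrier hc hε h0 hα
  · exact dyadicGap10All_shellBarrier hc h0 hε1 hα

/-! ## Uniform KP permutation networks -/

/-- **Uniform KP permutation networks, `ε₀ ∈ [1/4, 9/25]`** (`θ = 101/200`, `D = 100`), by the strand transfer
`kpPerm_shellBound_of_chain` applied to `dyadicGap21Low_shellBarrier`. MODEL lattice statement. [cite: BarbatoMorandinRomito2011, §3.2] -/
theorem kpPerm_shellBarrier_gapRange21 {σ : Equiv.Perm (Fin 4)} {c : Fin 4 → ℝ} {ε₀ : ℝ}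
    (hcyc : ∀ a, c (σ a) = c a) (hc : ∀ a, 0 ≤ c a) (hε : (1 : ℝ) / 4 ≤ ε₀)
    (hε1 : ε₀ ≤ (9 : ℝ) / 25) :
    ∀ ν : ℝ, 0 < ν → ∀ (X₀ : Fin 4 → ℝ) (s : ℝ), 0 < s → ∀ X : Fin 4 → ℤ → ℝ → ℝ,
      (∀ (i : Fin 4) (k : ℤ), X i k 0 = if k = 0 then X₀ i else 0) →
      (∀ (i : Fin 4) (k : ℤ), k < 0 → ∀ t : ℝ, X i k t = 0) →
      (∃ M : ℝ, ∀ (t : ℝ) (i : Fin 4) (k : ℤ), (1 + (1 + ε₀) ^ ((10 : ℝ) * k)) * |X i k t| ≤ M) →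
      (∀ (i : Fin 4) (k : ℤ), Continuous (X i k)) →
      (∀ (i : Fin 4) (k : ℤ), ∀ t ∈ Set.Icc (0 : ℝ) s, HasDerivWithinAt (X i k)
        (quadTerm ε₀ (kpPermTable σ c) X i k t - ν * (1 + ε₀) ^ ((2 : ℝ) * k) * X i k t)
        (Set.Icc (0 : ℝ) s) t) →
      (∀ t ∈ Set.Icc (0 : ℝ) s, ∀ (i : Fin 4) (k : ℤ), 1 ≤ k → 0 ≤ X i k t) →
      ∀ t ∈ Set.Icc (0 : ℝ) s, ∀ (i : Fin 4) (k : ℕ),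
        (1 + ε₀) ^ (2 * (101 / 200) * (k : ℝ)) * ((1 / 2 : ℝ) * X i (k : ℤ) t ^ 2) ≤
          100 * (∑ j : Fin 4, (1 / 2 : ℝ) * X₀ j ^ 2) :=
  kpPerm_shellBound_of_chain hcyc (by linarith) (by norm_num) fun a ha =>
    dyadicGap21Low_shellBarrier (lt_of_le_of_ne (hc a) (Ne.symm ha)) hε hε1
      (α := fun i₁ i₂ i₃ μ => c a * dyadicTable i₁ i₂ i₃ μ) (fun _ _ _ _ => rfl)

/-- **`ShellBarrierAt R ε₀ (kpPermTable σ c)` for every spread `R`, every `ε₀ ∈ [1/4, 1]`, every `σ` and EVERY orbit-constant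
`c`** (split at `9/25` onto `kpPermGap10Wide_shellBarrierAt`). MODEL lattice statement. [cite: BarbatoMorandinRomito2011, §3.2] -/
theorem kpPermGap21Wide_shellBarrierAt {σ : Equiv.Perm (Fin 4)} {c : Fin 4 → ℝ}
    (hcyc : ∀ a, c (σ a) = c a) :
    ∀ R : ℝ, ∀ ε₀ : ℝ, (1 : ℝ) / 4 ≤ ε₀ → ε₀ ≤ 1 → ShellBarrierAt R ε₀ (kpPermTable σ c) := by
  intro R ε₀ hε hε1
  rcases le_or_gt ε₀ ((9 : ℝ) / 25) with h | h
  · intro _hT hO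
    have hc : ∀ a, 0 ≤ c a := kpPerm_coeff_nonneg_of_orthant hO
    exact ⟨101 / 200, by norm_num, 100, by norm_num, kpPerm_shellBarrier_gapRange21 hcyc hc hε h⟩
  · exact kpPermGap10Wide_shellBarrierAt hcyc R ε₀ h.le hε1

/-- **Tail ceiling for uniform KP permutation networks on `ε₀ ∈ [1/4, 1]`.** [cite: BarbatoMorandinRomito2011, §3.2] -/
theorem kpPermGap21Wide_ceilingAt {σ : Equiv.Perm (Fin 4)} {c : Fin 4 → ℝ} (hcyc : ∀ a, c (σ a) = c a) :
    ∀ R : ℝ, ∀ ε₀ : ℝ, (1 : ℝ) / 4 ≤ ε₀ → ε₀ ≤ 1 → CeilingAt R ε₀ (kpPermTable σ c) := by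
  intro R ε₀ hε hε1
  exact subOnsagerCeiling_ceilingAt_of_shellBarrierAt (by linarith)
    (kpPermGap21Wide_shellBarrierAt hcyc R ε₀ hε hε1)

/-! ## Uniform KP fan networks -/

/-- **Uniform KP fan networks, `ε₀ ∈ [1/4, 9/25]`** (`dyadicGap21Low_shellBarrier` BY NAME through `kpFan_shellBound_of_chain`).
MODEL lattice statement. [cite: BarbatoMorandinRomito2011, §3.2] -/
theorem kpFan_shellBarrier_gapRange21 {w : Fin 4 → ℝ} {ε₀ : ℝ} (hw : ∀ a, 0 ≤ w a)
    (hε : (1 : ℝ) / 4 ≤ ε₀) (hε1 : ε₀ ≤ (9 : ℝ) / 25) :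
    ∀ ν : ℝ, 0 < ν → ∀ (X₀ : Fin 4 → ℝ) (s : ℝ), 0 < s → ∀ X : Fin 4 → ℤ → ℝ → ℝ,
      (∀ (i : Fin 4) (k : ℤ), X i k 0 = if k = 0 then X₀ i else 0) →
      (∀ (i : Fin 4) (k : ℤ), k < 0 → ∀ t : ℝ, X i k t = 0) →
      (∃ M : ℝ, ∀ (t : ℝ) (i : Fin 4) (k : ℤ), (1 + (1 + ε₀) ^ ((10 : ℝ) * k)) * |X i k t| ≤ M) →
      (∀ (i : Fin 4) (k : ℤ), Continuous (X i k)) →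
      (∀ (i : Fin 4) (k : ℤ), ∀ t ∈ Set.Icc (0 : ℝ) s, HasDerivWithinAt (X i k)
        (quadTerm ε₀ (kpFanTable w) X i k t - ν * (1 + ε₀) ^ ((2 : ℝ) * k) * X i k t)
        (Set.Icc (0 : ℝ) s) t) →
      (∀ t ∈ Set.Icc (0 : ℝ) s, ∀ (i : Fin 4) (k : ℤ), 1 ≤ k → 0 ≤ X i k t) →
      ∀ t ∈ Set.Icc (0 : ℝ) s, ∀ (i : Fin 4) (k : ℕ),
        (1 + ε₀) ^ (2 * (101 / 200) * (k : ℝ)) * ((1 / 2 : ℝ) * X i (k : ℤ) t ^ 2) ≤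
          100 * (∑ j : Fin 4, (1 / 2 : ℝ) * X₀ j ^ 2) := by
  intro ν hν X₀ s hs X hinit hlow hbd hcont hder hnn
  refine kpFan_shellBound_of_chain hw (by linarith) (by norm_num) (fun hW => ?_) hν hs hinit hlow hbd
    hcont hder hnn
  have hpos : 0 < ∑ j, w j ^ 2 :=
    lt_of_le_of_ne (Finset.sum_nonneg fun j _ => sq_nonneg (w j)) (Ne.symm hW)
  exact dyadicGap21Low_shellBarrier hpos hε hε1
    (α := fun i₁ i₂ i₃ μ => (∑ j, w j ^ 2) * dyadicTable i₁ i₂ i₃ μ) (fun _ _ _ _ => rfl)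

/-- **`ShellBarrierAt R ε₀ (kpFanTable w)` for every spread `R`, every `ε₀ ∈ [1/4, 1]` and EVERY weight vector `w`** (split at
`9/25` onto `kpFanGap10Wide_shellBarrierAt`). MODEL lattice statement. [cite: BarbatoMorandinRomito2011, §3.2] -/
theorem kpFanGap21Wide_shellBarrierAt (w : Fin 4 → ℝ) :
    ∀ R : ℝ, ∀ ε₀ : ℝ, (1 : ℝ) / 4 ≤ ε₀ → ε₀ ≤ 1 → ShellBarrierAt R ε₀ (kpFanTable w) := by
  intro R ε₀ hε hε1
  rcases le_or_gt ε₀ ((9 : ℝ) / 25) with h | h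
  · intro _hT hO
    have hw : ∀ a, 0 ≤ w a := kpFan_coeff_nonneg_of_orthant hO
    exact ⟨101 / 200, by norm_num, 100, by norm_num, kpFan_shellBarrier_gapRange21 hw hε h⟩
  · exact kpFanGap10Wide_shellBarrierAt w R ε₀ h.le hε1

/-- **Tail ceiling for uniform fan networks on `ε₀ ∈ [1/4, 1]`.** [cite: BarbatoMorandinRomito2011, §3.2] -/
theorem kpFanGap21Wide_ceilingAt (w : Fin 4 → ℝ) :
    ∀ R : ℝ, ∀ ε₀ : ℝ, (1 : ℝ) / 4 ≤ ε₀ → ε₀ ≤ 1 → CeilingAt R ε₀ (kpFanTable w) := by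
  intro R ε₀ hε hε1
  exact subOnsagerCeiling_ceilingAt_of_shellBarrierAt (by linarith) (kpFanGap21Wide_shellBarrierAt w R ε₀ hε hε1)

/-! ## The uniform 2-cycle -/

/-- **Uniform KP 2-cycle, `ε₀ ∈ [1/4, 9/25]`** (`dyadicGap21Low_shellBarrier` BY NAME through `kpTwoCycle_shellBarrier_of_chain`).
MODEL lattice statement. [cite: BarbatoMorandinRomito2011, §3.2] -/
theorem kpTwoCycle_shellBarrier_gapRange21 {c ε₀ : ℝ} (hc : 0 < c) (hε : (1 : ℝ) / 4 ≤ ε₀)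
    (hε1 : ε₀ ≤ (9 : ℝ) / 25) :
    ∀ ν : ℝ, 0 < ν → ∀ (X₀ : Fin 4 → ℝ) (s : ℝ), 0 < s → ∀ X : Fin 4 → ℤ → ℝ → ℝ,
      (∀ (i : Fin 4) (k : ℤ), X i k 0 = if k = 0 then X₀ i else 0) →
      (∀ (i : Fin 4) (k : ℤ), k < 0 → ∀ t : ℝ, X i k t = 0) →
      (∃ M : ℝ, ∀ (t : ℝ) (i : Fin 4) (k : ℤ), (1 + (1 + ε₀) ^ ((10 : ℝ) * k)) * |X i k t| ≤ M) →
      (∀ (i : Fin 4) (k : ℤ), Continuous (X i k)) →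
      (∀ (i : Fin 4) (k : ℤ), ∀ t ∈ Set.Icc (0 : ℝ) s, HasDerivWithinAt (X i k)
        (quadTerm ε₀ (kpTwoCycleTable c c) X i k t - ν * (1 + ε₀) ^ ((2 : ℝ) * k) * X i k t)
        (Set.Icc (0 : ℝ) s) t) →
      (∀ t ∈ Set.Icc (0 : ℝ) s, ∀ (i : Fin 4) (k : ℤ), 1 ≤ k → 0 ≤ X i k t) →
      ∀ t ∈ Set.Icc (0 : ℝ) s, ∀ (i : Fin 4) (k : ℕ),
        (1 + ε₀) ^ (2 * (101 / 200) * (k : ℝ)) * ((1 / 2 : ℝ) * X i (k : ℤ) t ^ 2) ≤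
          100 * (∑ j : Fin 4, (1 / 2 : ℝ) * X₀ j ^ 2) :=
  kpTwoCycle_shellBarrier_of_chain (by linarith) (by norm_num)
    (dyadicGap21Low_shellBarrier hc hε hε1 (α := fun i₁ i₂ i₃ μ => c * dyadicTable i₁ i₂ i₃ μ)
      (fun _ _ _ _ => rfl))

/-- **`ShellBarrierAt R ε₀ (kpTwoCycleTable c c)` for every `R`, every `ε₀ ∈ [1/4, 1]`, every `c > 0`** (split at `9/25` onto
`kpTwoCycleGap10Wide_shellBarrierAt`). MODEL lattice statement. [cite: BarbatoMorandinRomito2011, §3.2] -/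
theorem kpTwoCycleGap21Wide_shellBarrierAt {c : ℝ} (hc : 0 < c) :
    ∀ R : ℝ, ∀ ε₀ : ℝ, (1 : ℝ) / 4 ≤ ε₀ → ε₀ ≤ 1 → ShellBarrierAt R ε₀ (kpTwoCycleTable c c) := by
  intro R ε₀ hε hε1
  rcases le_or_gt ε₀ ((9 : ℝ) / 25) with h | h
  · intro _hT _hO
    exact ⟨101 / 200, by norm_num, 100, by norm_num, kpTwoCycle_shellBarrier_gapRange21 hc hε h⟩
  · exact kpTwoCycleGap10Wide_shellBarrierAt hc R ε₀ h.le hε1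

/-- **Tail ceiling for the uniform 2-cycle on `ε₀ ∈ [1/4, 1]`.** [cite: BarbatoMorandinRomito2011, §3.2] -/
theorem kpTwoCycleGap21Wide_ceilingAt {c : ℝ} (hc : 0 < c) :
    ∀ R : ℝ, ∀ ε₀ : ℝ, (1 : ℝ) / 4 ≤ ε₀ → ε₀ ≤ 1 → CeilingAt R ε₀ (kpTwoCycleTable c c) := by
  intro R ε₀ hε hε1
  exact subOnsagerCeiling_ceilingAt_of_shellBarrierAt (by linarith)
    (kpTwoCycleGap21Wide_shellBarrierAt hc R ε₀ hε hε1)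

/-! ## Mixed permutation networks -/

/-- **MIXED PERMUTATION NETWORKS SATISFY THE PRIMARY GRADED BARRIER AT EVERY `ε₀ ∈ [1/4, 1]`** (`θ = 101/200`,
`D = 100 + ((1+ε₀)²)^4`): the conditional transfer `kpPerm_mixed_primaryGraded_of_chain` (every `σ`-orbit uniform-live or
with a dead predecessor) discharged by `dyadicGap21All_shellBarrier`. This is the conclusion of `PrimaryGradedAt R ε₀ (kpPermTable σ c)`
verbatim on the whole ratio range of the registered stub `stub_primaryGradedLargeRatio`. MODEL lattice statement; no stub, crux or
summit is proved. [cite: BarbatoMorandinRomito2011, §3.2] [cite: Tao2016AveragedNS, §4 (4.13)] -/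
theorem kpPerm_mixed_primaryGraded_gap21 (σ : Equiv.Perm (Fin 4)) (c : Fin 4 → ℝ) {ε₀ : ℝ}
    (hε : (1 : ℝ) / 4 ≤ ε₀) (hε1 : ε₀ ≤ 1)
    (hmix : ∀ i : Fin 4, ((∀ b, σ.SameCycle i b → c b = c i) ∧ c i ≠ 0) ∨
      ∃ j : ℕ, j < 4 ∧ c ((σ.symm ^ (j + 1)) i) = 0) (R : ℝ) :
    Literature.Analysis.FluidPDE.TaoCascade.InTableClass R (kpPermTable σ c) →
    (∀ (Y : Fin 4 → ℤ → ℝ → ℝ) (τ : ℝ), (∀ (j : Fin 4) (k : ℤ), 1 ≤ k → 0 ≤ Y j k τ) → ∀ δ : ℝ, 0 < δ →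
      ∀ (i : Fin 4) (n : ℤ), 1 ≤ n → Y i n τ = 0 →
        0 ≤ Literature.Analysis.FluidPDE.TaoCascade.quadTerm δ (kpPermTable σ c) Y i n τ) →
    (∀ a b i : Fin 4, a ≠ b → kpPermTable σ c a b i (0, 0, 1) = 0) →
    ∃ (lev : Fin 4 → ℕ) (L : ℕ), (∀ a, lev a ≤ L) ∧
      (∀ a, lev a ≠ 0 → (∃ e, kpPermTable σ c a a e (0, 0, 1) ≠ 0) →
        (∀ j, kpPermTable σ c j j a (0, 0, 1) ≠ 0 →
          lev j < lev a ∧ (lev j = 0 ∨ ∃ e', kpPermTable σ c j j e' (0, 0, 1) ≠ 0)) ∧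
        (∀ i₁ i₂, i₁ ≠ a → i₂ ≠ a → kpPermTable σ c i₁ i₂ a (0, 0, 0) ≠ 0 →
          (lev i₁ < lev a ∧ (lev i₁ = 0 ∨ ∃ e', kpPermTable σ c i₁ i₁ e' (0, 0, 1) ≠ 0)) ∧
          (lev i₂ < lev a ∧ (lev i₂ = 0 ∨ ∃ e', kpPermTable σ c i₂ i₂ e' (0, 0, 1) ≠ 0))) ∧
        (∃ e, kpPermTable σ c a a e (0, 0, 1) ≠ 0 ∧
          (∀ j, kpPermTable σ c e e j (0, 0, 1) ≠ 0 →
            lev j < lev a ∧ (lev j = 0 ∨ ∃ e', kpPermTable σ c j j e' (0, 0, 1) ≠ 0)) ∧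
          (∀ j, j ≠ e → kpPermTable σ c e e j (0, 0, 0) ≠ 0 →
            lev j < lev a ∧ (lev j = 0 ∨ ∃ e', kpPermTable σ c j j e' (0, 0, 1) ≠ 0)))) ∧
      ∃ θ : ℝ, 1 / 2 < θ ∧ θ ≤ 1 ∧ ∃ D : ℝ, 0 ≤ D ∧
        ∀ ν : ℝ, 0 < ν → ∀ (X₀ : Fin 4 → ℝ) (s : ℝ), 0 < s → ∀ X : Fin 4 → ℤ → ℝ → ℝ,
        (∀ (i : Fin 4) (k : ℤ), X i k 0 = if k = 0 then X₀ i else 0) →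
        (∀ (i : Fin 4) (k : ℤ), k < 0 → ∀ t : ℝ, X i k t = 0) →
        (∃ M : ℝ, ∀ (t : ℝ) (i : Fin 4) (k : ℤ), (1 + (1 + ε₀) ^ ((10 : ℝ) * k)) * |X i k t| ≤ M) →
        (∀ (i : Fin 4) (k : ℤ), Continuous (X i k)) →
        (∀ (i : Fin 4) (k : ℤ), ∀ t ∈ Set.Icc (0 : ℝ) s, HasDerivWithinAt (X i k)
          (Literature.Analysis.FluidPDE.TaoCascade.quadTerm ε₀ (kpPermTable σ c) X i k t -
            ν * (1 + ε₀) ^ ((2 : ℝ) * k) * X i k t) (Set.Icc (0 : ℝ) s) t) →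
        (∀ t ∈ Set.Icc (0 : ℝ) s, ∀ (i : Fin 4) (k : ℤ), 1 ≤ k → 0 ≤ X i k t) →
        ∀ t ∈ Set.Icc (0 : ℝ) s, ∀ i, lev i = 0 → ∀ k : ℕ,
          (1 + ε₀) ^ (2 * θ * (k : ℝ)) * ((1 / 2 : ℝ) * X i (k : ℤ) t ^ 2) ≤
            D * (∑ j : Fin 4, (1 / 2 : ℝ) * X₀ j ^ 2) :=
  kpPerm_mixed_primaryGraded_of_chain σ c (θ₀ := 101 / 200) (D₀ := 100) (by linarith) (by norm_num)
    (by norm_num) (by norm_num) hmix (fun a hca => dyadicGap21All_shellBarrier hca hε hε1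
      (α := fun i₁ i₂ i₃ μ => c a * dyadicTable i₁ i₂ i₃ μ) (fun _ _ _ _ => rfl)) R

end Summit.NavierStokesRegularity.NavierStokesRegularity.Theorems

end
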